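import Summits.NavierStokesRegularity.NavierStokesRegularity.Theorems.AxisymmetricExtremalityPFoldToAxisymmetric
import Summits.NavierStokesRegularity.NavierStokesRegularity.Theorems.AxisymmetricExtremalityAxisymmetricKatoGlobalNoSwirlStratum
import Summits.NavierStokesRegularity.NavierStokesRegularity.Theorems.AxisymmetricExtremalityAxisymmetricKatoGlobalReduction
import Summits.NavierStokesRegularity.NavierStokesRegularity.Theorems.AxisymmetricExtremalityClayDatumCritical
import Summits.NavierStokesRegularity.NavierStokesRegularity.Theorems.AxisymmetricSwirlRegularity
import HarnessLib

/-!
# Strategist s20-g4 (census family `s`, independent) — typed attempts on the crux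
`AxisymmetricExtremality.AxisymmetricKatoGlobal` (stmt-NavierStokesRegularity-15453)

Kernel-checked bookkeeping behind `STRATEGY-CENSUS-s20-g4.md` (no new mathematics, 0 sorry):

* §W  `NoAxisymMinimalDatum` — the THRESHOLD INSTANCE of the crux, the weakest statement that can
  replace it in the route's deciding theorem (`closes_of_noAxisymMinimalDatum`, re-glued with the
  PROVED sibling crux `PFoldToAxisymmetric`); the crux implies it (`noAxisymMinimalDatum_of_crux`);
  its swirl-free stratum is a theorem (`noAxisymMinimalDatum_noSwirl_stratum`, from the landed
  `axisymmetricKatoGlobal_noSwirl_stratum`); relative strength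
  `NoAxisymMinimalDatum → (MinimalDatumPFold ↔ NavierStokesRegularity)`.
* §D  the vacuity costume of every "threshold property" split of §W
  (`thresholdPiece_of_noAxisymMinimalDatum` / `noAxisymMinimalDatum_of_thresholdPiece`): a split
  `W ⇐ (every axisymmetric minimal datum has P) ∧ (P ⇒ global)` whose second piece is a theorem has
  a first piece EQUIVALENT to `W`; and the landed genuine `k = 2` split of the crux itself
  (`AxisymmetricKatoGlobal_of_logSwirlFacts`, p150628) anchored by name.
* §T  the crux sits ABOVE the named open problem ns.S25 (Ladyzhenskaya 1968: axisymmetric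
  regularity WITH swirl): `axisymmetricSwirlRegularity_of_crux :
  AxisymmetricKatoGlobal → Summit.…​.AxisymmetricSwirlRegularity` (Kato→Clay, PROVED facts only).
-/

set_option linter.dupNamespace false

noncomputable section

open Set MeasureTheory Filter Function
open Literature.Analysis.FluidPDE
open Summit.NavierStokesRegularity.NavierStokesRegularity.Theses.AxisymmetricExtremality

namespace Summit.NavierStokesRegularity.NavierStokesRegularity.Cruxes.AxisymmetricKatoGlobal.StrategistS20g4

/-- velocity fields on `ℝ³` -/
abbrev V := EuclideanSpace ℝ (Fin 3) → EuclideanSpace ℝ (Fin 3)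
/-- the bundled critical space `Ḣ^{1/2}(ℝ³; ℂ³)` -/
abbrev H := Literature.Analysis.FunctionSpaces.HomSobolev (EuclideanSpace ℝ (Fin 3))
  (EuclideanSpace ℂ (Fin 3)) (1 / 2 : ℝ)

/-! ## §W — weakest admissible replacement: the threshold instance -/

/-- **W₀′ (threshold instance of the crux).** For every `ν > 0` there is NO axisymmetric
Rusin–Šverák minimal blow-up datum. This is literally all that `closes` consumes of the crux. -/
def NoAxisymMinimalDatum : Prop :=
  ∀ ν : ℝ, 0 < ν → ¬ ∃ (u₀ : V) (g : H), IsMinimalBlowupDatum ν u₀ g ∧ IsAxisymmetric u₀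

/-- crux ⇒ W₀′ (pure logic; the written-out equivariance of the crux is `IsAxisymmetric`
definitionally). -/
theorem noAxisymMinimalDatum_of_crux (h : AxisymmetricKatoGlobal) : NoAxisymMinimalDatum := by
  rintro ν hν ⟨u₀, g, ⟨hL3, hrep, hdiv, -, hnot⟩, hax⟩
  exact hnot (h ν hν u₀ g hL3 hrep hdiv (fun θ x => hax θ x))

/-- **W₀′ re-glues the route**: `MinimalDatumPFold → W₀′ → NavierStokesRegularity`, using the
PROVED sibling crux `PFoldToAxisymmetric` (`axisymmetricExtremality_pFoldToAxisymmetric_proof`). -/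
theorem closes_of_noAxisymMinimalDatum (h₂ : MinimalDatumPFold) (hW : NoAxisymMinimalDatum) :
    _root_.NavierStokesRegularity := by
  show Literature.NS.NavierStokesExistenceSmoothR3
  intro ν hν u₀ hsm hdiv hdec
  by_contra hno
  obtain ⟨u₁, g, hmin, hax⟩ :=
    Theorems.axisymmetricExtremality_pFoldToAxisymmetric_proof ν hν (h₂ ν hν ⟨u₀, hsm, hdiv, hdec, hno⟩)
  exact hW ν hν ⟨u₁, g, hmin, fun θ x => hax θ x⟩

/-- Vacuity of the topological crux under Clay (A) (its antecedent is verbatim Clay failure at `ν`;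
same statement as the landed `MinimalDatumPFold.Negative.cruxBody_of_navierStokesRegularity`,
re-proved here to keep this sketch's imports inside the farm's built snapshot). -/
theorem minimalDatumPFold_of_summit (hS : _root_.NavierStokesRegularity) : MinimalDatumPFold := by
  rintro ν hν ⟨v₀, hsm, hdiv, hdec, hno⟩
  exact (hno ((show Literature.NS.NavierStokesExistenceSmoothR3 from hS) ν hν v₀ hsm hdiv hdec)).elim

/-- Relative strength with W₀′ in place of the crux (cf. the landed
`stub_minimalDatumPFoldIffSummitOfAXH`): given W₀′, the topological crux IS Clay (A). -/
theorem minimalDatumPFold_iff_summit_of_noAxisymMinimalDatum (hW : NoAxisymMinimalDatum) :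
    MinimalDatumPFold ↔ _root_.NavierStokesRegularity :=
  ⟨fun h₂ => closes_of_noAxisymMinimalDatum h₂ hW, minimalDatumPFold_of_summit⟩

/-- **The swirl-free stratum of W₀′ is a theorem** (every `ν > 0`): no axisymmetric minimal
blow-up datum is swirl-free — from the landed `axisymmetricKatoGlobal_noSwirl_stratum`. -/
theorem noAxisymMinimalDatum_noSwirl_stratum :
    ∀ ν : ℝ, 0 < ν → ¬ ∃ (u₀ : V) (g : H),
      IsMinimalBlowupDatum ν u₀ g ∧ IsAxisymmetric u₀ ∧ HasNoSwirl u₀ := by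
  rintro ν hν ⟨u₀, g, ⟨hL3, -, hdiv, -, hnot⟩, hax, hsw⟩
  exact hnot (Theorems.AxisymmetricKatoGlobal.NoSwirlStratum.axisymmetricKatoGlobal_noSwirl_stratum
    ν hν u₀ hL3 hdiv (fun θ x => hax θ x) hsw)

/-! ## §D — decompositions -/

/-- **Vacuity costume, direction 1.** ANY "threshold property" `P` of axisymmetric minimal data is
implied by W₀′. -/
theorem thresholdPiece_of_noAxisymMinimalDatum (P : ℝ → V → H → Prop) (hW : NoAxisymMinimalDatum) :
    ∀ ν : ℝ, 0 < ν → ∀ (u₀ : V) (g : H), IsMinimalBlowupDatum ν u₀ g → IsAxisymmetric u₀ → P ν u₀ g :=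
  fun ν hν u₀ g hmin hax => (hW ν hν ⟨u₀, g, hmin, hax⟩).elim

/-- **Vacuity costume, direction 2 (the assembly).** A split `W₀′ ⇐ (P holds at threshold) ∧
(P ⇒ global Kato solution)` assembles; hence whenever the second piece is a THEOREM (e.g. `P` =
"the Kato solution blows up at Type I rate" with KNSS/Seregin–Šverák = barrier
`AxisymmetricTypeIExclusion`, or `P` = "swirl-free" with the stratum above), the first piece is
EQUIVALENT to W₀′ by `thresholdPiece_of_noAxisymMinimalDatum` — it is W₀′ in costume. -/
theorem noAxisymMinimalDatum_of_thresholdPiece (P : ℝ → V → H → Prop)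
    (hP : ∀ ν : ℝ, 0 < ν → ∀ (u₀ : V) (g : H), IsMinimalBlowupDatum ν u₀ g → IsAxisymmetric u₀ → P ν u₀ g)
    (hreg : ∀ ν : ℝ, 0 < ν → ∀ (u₀ : V) (g : H), IsMinimalBlowupDatum ν u₀ g → IsAxisymmetric u₀ →
      P ν u₀ g → HasGlobalKatoSolution ν u₀) :
    NoAxisymMinimalDatum := by
  rintro ν hν ⟨u₀, g, hmin, hax⟩
  exact hmin.2.2.2.2 (hreg ν hν u₀ g hmin hax (hP ν hν u₀ g hmin hax))

/-- The landed genuine `k = 2` split of the crux (p150628): Seregin's 2022 criterion (piece 1, a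
theorem in print, named fact `seregin2022_logSwirl_regularAtOrigin`) and the swirl axis-modulus
(piece 2, verbatim the registered `stub_swirlAxisModulus`) imply the crux — anchored by name. -/
example := @Theorems.AxisymmetricKatoGlobal.Registered.AxisymmetricKatoGlobal_of_logSwirlFacts

/-! ## §T — the crux sits above the named open problem ns.S25 (AX) -/

/-- **crux ⇒ AX (ns.S25, Ladyzhenskaya's axisymmetric-with-swirl problem).** A Clay datum is a
critical datum (`ClayDatumCritical`, PROVED), the crux gives it a global Kato solution, and
Kato→Clay (`clay_solution_of_hasGlobalKatoSolution_holds`, PROVED) a global classical bounded-energy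
solution. So any proof of the crux proves the conjecture leaf
`Summit.NavierStokesRegularity.NavierStokesRegularity.AxisymmetricSwirlRegularity`. -/
theorem axisymmetricSwirlRegularity_of_crux (h : AxisymmetricKatoGlobal) :
    Summit.NavierStokesRegularity.NavierStokesRegularity.AxisymmetricSwirlRegularity := by
  intro ν hν u₀ hsm hdiv hdec hax
  have hdivW : NSWave0.IsDivFree u₀ := fun x => hdiv x
  obtain ⟨hL3, hwdiv, g, hrep⟩ :=
    Theorems.axisymmetricExtremality_clayDatumCritical_proof u₀ hsm hdivW hdec
  have hK : HasGlobalKatoSolution ν u₀ := h ν hν u₀ g hL3 hrep hwdiv (fun θ x => hax θ x)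
  obtain ⟨u, p, hu, hp, hns, hbe⟩ :=
    clay_solution_of_hasGlobalKatoSolution_holds ν hν u₀ hsm hdivW hdec hK
  obtain ⟨hcl, h0⟩ := isNavierStokesSolution_and_smooth_iff.1 ⟨hns, hu, hp⟩
  exact ⟨u, p, hcl, h0, hbe⟩

end Summit.NavierStokesRegularity.NavierStokesRegularity.Cruxes.AxisymmetricKatoGlobal.StrategistS20g4

end
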